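import Literature.NumberTheory.EllipticCurves.Rank1Residual.X10RankOne
import Literature.NumberTheory.EllipticCurves.BurungaleSkinnerTianWan2024.CyclotomicPConverseSkinnerUrbanProofs
import HarnessLib

/-!
# Class X10 ∧ r = 1, BF-free route at `p = 3`: the twist's (irr) and (ram) DERIVED from `E`'s
# (cell `b2b-bsdres` X10 lane × typing layer `bsd-littype-01`; PROOFS ONLY)

HONEST FRAMING (run/shared/lean/b2b/bsd-rank1-residual/, verbatim): the goal of the cell is to
DELETE the COMBINATION-SHAPED residual classes for ALL analytic-rank `≤ 1` elliptic curves over `ℚ`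
— "full BSD formula for every rank `≤ 1` curve in class C" assembled STRICTLY from published
theorems — so that the rank-`≤ 1` remainder becomes exactly the CONSTRUCTION-SHAPED classes, which
are TYPED (missing-input `Prop`s), NOT attempted. This is not "finishing BSD".

`X10RankOne.lean` (`X10.bsdp_three_rankOne_of_kolyvagin_of_skinner`,
`X10.bsdp_three_rankOne_of_jetchev_of_skinner`) discharges the twist's `BSD(E^{(d_K)},3)` from
Skinner 2016 Thm. C through `bsdp_three_of_L_one_ne_zero_of_ram`, taking FOUR facts about a globally
minimal model `Wd` of `E^{(d_K)}` as per-curve HYPOTHESES: `hredD` (good ordinary or multiplicative at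
`3`), `hirrD` (`E^{(d_K)}[3]` irreducible), `hramD` (a ramified multiplicative prime `ℓ ≠ 3` with
`3 ∤ ord_ℓ Δ_min`) and `hLD` (`L(E^{(d_K)},1) ≠ 0`); its docstring records WHY two of them hold ("the
(ram) prime `ℓ` of `E` splits in `K`, so `E^{(d_K)} ≅ E` over `ℚ_ℓ`"; "`E^{(d_K)}[3] ≅ E[3] ⊗ χ_K`
irreducible") without proving it. This file PROVES those two, for every Heegner field `K` of a level
`N` divisible by `N_E` (so every prime of bad reduction splits in `K`):

* `hirrD` from (irr) for `E`: irreducibility of `E[p]` passes to quadratic twists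
  (`BurungaleSkinnerTianWan2024.hasIrreducibleModPGaloisRep_of_smul_eq_quadraticTwist`, Silverman
  *AEC* X.5 Cor. 5.4);
* `hramD` from (ram) for `E` — the typing layer's (ram)-TRANSFER LEMMA
  `BurungaleSkinnerTianWan2024.exists_ram_twist_of_satisfiesHeegnerHypothesis`: the (ram) prime
  `ℓ ∣ N_E` splits in `K`, so `d_K ∈ (ℚ_ℓ^×)²`, `E^{(d_K)} ⊗ ℚ_ℓ ≅ E ⊗ ℚ_ℓ` over `ℚ_ℓ`, and the
  reduction type at `ℓ` and `ord_ℓ Δ_min` are `ℚ_ℓ`-isomorphism invariants (Silverman *AEC* VII.5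
  Prop. 5.1 (b), VII.1 Prop. 1.3 (b); uniform in `ℓ`, including `ℓ = 2`);

and restates the two X10 theorems with `hram : Ram W 3` for `E` in place of `hirrD`, `hramD`
(`X10.bsdp_three_rankOne_of_kolyvagin_of_skinner_of_ram`, `X10.bsdp_three_rankOne_of_jetchev_of_skinner_of_ram`).
`hredD` stays a hypothesis (it fails when `3 ∣ d_K`: the twist is then additive at `3`; when
`3 ∤ d_K` it is good ordinary, `isOrdinaryAt_of_smul_eq_quadraticTwist`), as does `hLD` (the choice
of `K`). On the X10a′ ∧ r = 1 census (X10-AUDIT §9: 25 pairs `N < 10⁴`, all carrying `ram(3)`) this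
removes two of the four per-pair twist certificates. Theorems only (kernel lane); nothing asserted.

References: [JetchevSkinnerWan2017] §7.4.1–7.4.2; [Skinner2016PacificMC] Thm. C; [SilvermanAEC2009]
VII.1 Prop. 1.3 (b), VII.5 Prop. 5.1 (b), X.5 Cor. 5.4; [NeukirchANT1999] I (8.5), II (4.6).
-/

noncomputable section

open scoped Classical

open WeierstrassCurve Literature.NumberTheory.EllipticCurves
  Literature.NumberTheory.EllipticCurves.BurungaleSkinnerTianWan2024

namespace Literature.NumberTheory.EllipticCurves.Rank1Residual

/-! ## The twist inherits (irr) and (ram) over a Heegner field -/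

/-- **`irr(p)` and `ram(p)` pass from `E` to `E^{(d_K)}` for a Heegner field `K` of any level `N`
with `N_E ∣ N`** (`Wd` any globally minimal model of the twist): `E^{(d_K)}[p] ≅ E[p] ⊗ χ_K` is
irreducible with `E[p]` (Silverman *AEC* X.5 Cor. 5.4), and the (ram) prime `ℓ ∣ N_E ∣ N` splits in
`K`, whence `E^{(d_K)} ⊗ ℚ_ℓ ≅ E ⊗ ℚ_ℓ` has the same reduction type and the same `ord_ℓ Δ_min`
(typing-layer lemma `exists_ram_twist_of_satisfiesHeegnerHypothesis`). The docstring claims of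
`X10.bsdp_three_rankOne_of_kolyvagin_of_skinner` ("hypotheses here, not derived"), derived.
[cite: SilvermanAEC2009, X.5 Cor. 5.4, VII.5 Prop. 5.1(b) and VII.1 Prop. 1.3(b)]
[cite: JetchevSkinnerWan2017, §7.4.1 (p. 30: the twist at the primes split in K)] -/
theorem irr_and_ram_twist_of_satisfiesHeegnerHypothesis {N : ℕ}
    (W : WeierstrassCurve ℚ) [W.IsElliptic] [W.IsGloballyMinimal] (p : ℕ) [Fact p.Prime]
    (hirr : Irr W p) (hram : Ram W p) (K : Type) [Field K] [NumberField K]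
    (h2 : Module.finrank ℚ K = 2) (hH : SatisfiesHeegnerHypothesis N K) (hcN : W.conductorNorm ℤ ∣ N)
    (Wd : WeierstrassCurve ℚ) [Wd.IsElliptic] [Wd.IsGloballyMinimal]
    (hWd : ∃ C : VariableChange ℚ, C • W.quadraticTwist (NumberField.discr K : ℚ) = Wd) :
    Irr Wd p ∧ Ram Wd p := by
  obtain ⟨C, hC⟩ := hWd
  have hC' : C⁻¹ • Wd = W.quadraticTwist (NumberField.discr K : ℚ) := by rw [← hC, inv_smul_smul]
  have hd : (NumberField.discr K : ℚ) ≠ 0 := by exact_mod_cast NumberField.discr_ne_zero K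
  exact ⟨hasIrreducibleModPGaloisRep_of_smul_eq_quadraticTwist W Wd p hd hC' hirr,
    exists_ram_twist_of_satisfiesHeegnerHypothesis W Wd K h2 (SatisfiesHeegnerHypothesis.of_dvd hcN hH)
      hC' p hram⟩

/-! ## The X10 ∧ r = 1 theorems at `p = 3` with the twist's (irr), (ram) derived -/

/-- **X10 ∧ r = 1 WITHOUT Yan–Zhu, Kolyvagin form, with `BSD(E^{(d_K)},3)` from Skinner 2016 Thm. C
and the twist's (irr)/(ram) DERIVED** (`X10.bsdp_three_rankOne_of_kolyvagin_of_skinner` with `hirrD`,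
`hramD` replaced by `hram : Ram W 3` for `E` itself and `N_E ∣ N`): for `E/ℚ` in class X10 with
`surj(3)` and `ram(3)`, a Heegner field `K` for a level `N` divisible by `N_E` with Heegner point
`P = y_K` of infinite order, a globally minimal model `Wd` of `E^{(d_K)}` that is good ordinary or
multiplicative at `3` with `L(E^{(d_K)},1) ≠ 0`, granted GZK, Kolyvagin's theorem and bound and
Skinner 2016 Thm. C (PUBLISHED named facts), the certificates `2·ord_3[E(K) : ℤ P] ≤ ord_3 #Ш(E^{(d_K)})_an`
and `ord_3 #Ш(E)_an = 0` give Miller's `BSD(E,3)`. No Beilinson–Flach input.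
[cite: Skinner2016PacificMC, Thm. C (§1)] [cite: McCallumLMS1991, §1 Theorem (Kolyvagin), p. 296]
[cite: JetchevSkinnerWan2017, §7.4.1–§7.4.2 (pp. 30–31)] [cite: Miller2011LMS, Def. 1.1] -/
theorem X10.bsdp_three_rankOne_of_kolyvagin_of_skinner_of_ram {N : ℕ} [NeZero N]
    (hSk : Skinner2016.thmC_padicValRat_bsd_rank_zero)
    (hGZK : rank_eq_analyticRank_of_analyticRank_le_one)
    (W : WeierstrassCurve ℚ) [W.IsElliptic] [W.IsGloballyMinimal]
    (hX : ClassX10 W 3) (hsurj : Surj W 3) (hram : Ram W 3) (hcN : W.conductorNorm ℤ ∣ N)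
    (K : Type) [Field K] [NumberField K]
    (hKo : kolyvagin N W K) (hKB : Kolyvagin1990_padicValNat_card_sha_le N W K)
    (hK : IsImaginaryQuadratic K) (hH : SatisfiesHeegnerHypothesis N K)
    {P : (W.baseChange K).toAffine.Point} (hP : IsHeegnerPoint N W K P) (hnt : ¬ IsOfFinAddOrder P)
    (Wd : WeierstrassCurve ℚ) [Wd.IsElliptic] [Wd.IsGloballyMinimal]
    (hWd : ∃ C : VariableChange ℚ, C • W.quadraticTwist (NumberField.discr K : ℚ) = Wd)
    (hredD : (Wd.HasGoodReductionAtPrime 3 ∧ ¬ (3 : ℤ) ∣ Wd.frobeniusTrace 3) ∨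
      Wd.HasMultiplicativeReductionAtPrime 3)
    (hLD : Wd.entireLFunction 1 ≠ 0)
    (hDB : ∃ q : ℚ, shaAn Wd = (q : ℂ) ∧
      ((2 * padicValNat 3 (AddSubgroup.zmultiples P).index : ℕ) : ℤ) ≤ padicValRat 3 q)
    (hunit : ∃ q : ℚ, shaAn W = (q : ℂ) ∧ padicValRat 3 q = 0) : BSDp W 3 := by
  obtain ⟨hirrD, hramD⟩ :=
    irr_and_ram_twist_of_satisfiesHeegnerHypothesis W 3 hX.2.2.1 hram K hK.1 hH hcN Wd hWd
  exact X10.bsdp_three_rankOne_of_kolyvagin_of_skinner hSk hGZK W hX hsurj K hKo hKB hK hH hP hnt Wd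
    hWd hredD hirrD hramD hLD hDB hunit

/-- **X10 ∧ r = 1 WITHOUT Yan–Zhu, Jetchev form (lever L11), with `BSD(E^{(d_K)},3)` from Skinner
2016 Thm. C and the twist's (irr)/(ram) DERIVED** (`X10.bsdp_three_rankOne_of_jetchev_of_skinner`
with `hirrD`, `hramD` replaced by `hram : Ram W 3` and `N_E ∣ N`): for an optimal `E/ℚ` in class X10
with `surj(3)` and `ram(3)`, a Heegner field `K` (`d_K ≠ -3`, Heegner hypothesis for a level `N` with
`3 ∤ N`, `N_E ∣ N`), Heegner point `P = y_K` of infinite order, a prime `q ∣ N`, a globally minimal model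
`Wd` of `E^{(d_K)}` good ordinary or multiplicative at `3` with `L(E^{(d_K)},1) ≠ 0`: granted GZK,
Jetchev 2008 Cor. 1.5 and Skinner 2016 Thm. C, the certificates
`2·ord_3[E(K) : ℤ P] − 2·ord_3 c_q(E) ≤ ord_3 #Ш(E^{(d_K)})_an` and `ord_3 #Ш(E)_an = 0` give `BSD(E,3)`.
[cite: Jetchev2008, Cor. 1.5 (p. 3)] [cite: Skinner2016PacificMC, Thm. C (§1)]
[cite: JetchevSkinnerWan2017, §7.4.1–§7.4.2 (pp. 30–31)] [cite: Miller2011LMS, Def. 1.1] -/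
theorem X10.bsdp_three_rankOne_of_jetchev_of_skinner_of_ram {N : ℕ} [NeZero N]
    (hJ : Jetchev2008.cor15_padicValNat_card_primaryComponent_sha_le)
    (hSk : Skinner2016.thmC_padicValRat_bsd_rank_zero)
    (hGZK : rank_eq_analyticRank_of_analyticRank_le_one)
    (W : WeierstrassCurve ℚ) [W.IsElliptic] [W.IsGloballyMinimal]
    (hX : ClassX10 W 3) (hsurj : Surj W 3) (hram : Ram W 3) (h3N : ¬ 3 ∣ N)
    (hcN : W.conductorNorm ℤ ∣ N)
    (K : Type) [Field K] [NumberField K]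
    (hK : IsImaginaryQuadratic K) (hD3 : NumberField.discr K ≠ -3)
    (hH : SatisfiesHeegnerHypothesis N K)
    (hopt : ∃ Dt : ModularForms.ModularParametrizationData W N,
      ∀ z ∈ Dt.L.lattice, ∃ w ∈ ModularForms.periodLattice Dt.f, z = (Dt.c : ℂ) * w)
    {P : (W.baseChange K).toAffine.Point} (hP : IsHeegnerPoint N W K P) (hnt : ¬ IsOfFinAddOrder P)
    (q : ℕ) [Fact q.Prime] (hqN : q ∣ N)
    (Wd : WeierstrassCurve ℚ) [Wd.IsElliptic] [Wd.IsGloballyMinimal]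
    (hWd : ∃ C : VariableChange ℚ, C • W.quadraticTwist (NumberField.discr K : ℚ) = Wd)
    (hredD : (Wd.HasGoodReductionAtPrime 3 ∧ ¬ (3 : ℤ) ∣ Wd.frobeniusTrace 3) ∨
      Wd.HasMultiplicativeReductionAtPrime 3)
    (hLD : Wd.entireLFunction 1 ≠ 0)
    (hDB : ∃ r : ℚ, shaAn Wd = (r : ℂ) ∧
      ((2 * padicValNat 3 (AddSubgroup.zmultiples P).index -
          2 * padicValNat 3 ((W.baseChange ℚ_[q]).localTamagawaNumber ℤ_[q]) : ℕ) : ℤ) ≤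
        padicValRat 3 r)
    (hunit : ∃ r : ℚ, shaAn W = (r : ℂ) ∧ padicValRat 3 r = 0) : BSDp W 3 := by
  obtain ⟨hirrD, hramD⟩ :=
    irr_and_ram_twist_of_satisfiesHeegnerHypothesis W 3 hX.2.2.1 hram K hK.1 hH hcN Wd hWd
  exact X10.bsdp_three_rankOne_of_jetchev_of_skinner hJ hSk hGZK W hX hsurj h3N K hK hD3 hH hopt hP
    hnt q hqN Wd hWd hredD hirrD hramD hLD hDB hunit

end Literature.NumberTheory.EllipticCurves.Rank1Residual

end
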